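import Summits.ABC.IUTFork.Repair.RHHullThresholdExact
import Summits.ABC.IUTFork.Cor312GenuineKDeepPlace
import HarnessLib

/-!
# D-0079 RESCUE sub-cell R-H, ROUND 2 Q3 — the l-TAIL of row 4 «hull-threshold-exact» (`RH.HullThresholdExact.HullCell`, p458452):
# in the tail the CERTIFIED three-valued column is constantly OPEN; the EXACT cell follows the true outer radius

Companion of `RHQ3LTail` (rows 3, 5; independent imports; seat abc-iut-rh2-q3-typ-1 g0; rung LADDER-ABC:A2.RESCUE.H). PROOF-ONLY (0 definitions). TAKES NO SIDE on
[IUTchIII] Cor. 3.12 or on any author; nothing here asserts abc; `HullCell` is row 4's CONJECTURED closed-form column (its own docstring), consumed BY NAME.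

Row 4 decides a cell `(w, j)` by the radii sandwich `r_out_lb := min_s (p^s − s·e_w) ≤ r_out ≤ r_in ≤ r_in_ub := ⌊e_w/(p−1)⌋ + 1`
(`RH.HullThresholdExact.not_hullCell_of_bounds` / `hullCell_of_bounds`): NEG-certified iff `¬HullCell e m j r_in_ub r_out_lb`, POS-certified iff
`HullCell e m j r_out_lb r_in_ub`. Along the l-axis of a fixed curve (`e_w ≥ l`, `2l·P_q(w) = e(w|v)·ord_v(q_v)` — see `RHQ3LTail`):
* `hullCell_of_linear` (integers): `1 ≤ r_in`, `r_out ≤ p^t − t·e`, `p^t ≤ e`, `(j−1)·m ≤ (t−1)·e ⟹ HullCell e m j r_in r_out`;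
* `hullCell_pilotDataOfK_of_ltail`: at a bad place of `pilotDataOfK D K`, `p^t ≤ l` and `ord_v(q_v) + 4e(v|p) ≤ 4e(v|p)·t` give `HullCell` at EVERY label
  for EVERY radii pair with `1 ≤ r_in`, `r_out ≤ p^t − t·e_w` — in particular the NEG-test pair (`r_in_ub ≥ 1`, `r_out_lb ≤ p^t − t·e_w` by definition of
  the minimum): NO cell of the datum is NEG-certified in the tail; and the EXACT radii whenever `r_out(K_w) ≤ p^t − t·e_w` (untied depth; R-W lane U
  «U2-LATTICE-INTEGERS», not in the tree) — then the datum IS in Σ₄;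
* `not_hullCell_swapped_of_ltail`: the POS-test pair (`r_in := r_out_lb ≤ p^t − t·e`, `r_out := r_in_ub ≥ 1`) FAILS for every `m ≥ 0`, `j ≥ 1` once
  `p² ≤ e_w`: NO cell is POS-certified in the tail;
* `hStarClosedForm_pilotDataOfK_of_ltail`: datum form for `RH.HullThresholdExact.HStarClosedForm` with radii supplied as data.
ANSWER WORD: Q3(row 4) = CONDITIONAL(on the exact outer radius `r_out(K_w)`; certified column OPEN throughout the tail; `l₀` as in row 3, exponential in
the local heights). [cite: Mochizuki2012, IUTchI Ex. 3.2 (iv) p. 71; IUTchIV Prop. 1.2 (i)(ii) p. 10, Prop. 1.4 p. 13] [cite: DupuyHilado2025, §3.4, §4.9]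
[claim: Mochizuki2012, status: disputed] for every IUT locution.
-/

noncomputable section

open Set Function NumberField IsDedekindDomain

namespace Summit.ABC.IUTFork.Repair.RH.Q3LTailHull

open Literature.IUT.LogThetaLattice Literature.IUT.LogVolume Literature.IUT.HodgeTheaters
open Summit.ABC.IUTFork.Thm311 Summit.ABC.IUTFork.Thm311.Real Summit.ABC.IUTFork.Cor312Prov Summit.ABC.IUTFork.Repair.RH.HullThresholdExact

section Row4

/-- **LINEAR SUFFICIENT TEST for the closed-form cell** (integers): `1 ≤ r_in`, `r_out ≤ p^t − t·e`, `p^t ≤ e`, `(j−1)·m ≤ (t−1)·e ⟹ HullCell e m j r_in r_out`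
(`e·⌊X/e⌋ ≤ X`; `−(j+1)·r_out ≥ (j+1)(t·e − p^t) ≥ (j+1)(t−1)e`). [folklore] -/
theorem hullCell_of_linear {p : ℕ} {e m j rin rout : ℤ} {t : ℕ} (he : 0 < e) (hj : 1 ≤ j) (hrin : 1 ≤ rin)
    (hrout : rout ≤ (p : ℤ) ^ t - t * e) (hpt : (p : ℤ) ^ t ≤ e) (hlin : (j - 1) * m ≤ ((t : ℤ) - 1) * e) :
    HullCell e m j rin rout := by
  unfold HullCell
  set X : ℤ := j ^ 2 * m - j * (e - 1) - (j + 1) * rin with hX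
  have hdiv : e * (X / e) ≤ X := Int.mul_ediv_self_le (ne_of_gt he)
  have hj0 : 0 ≤ j + 1 := by linarith
  have h1 : (j + 1) * (((t : ℤ) - 1) * e) ≤ -((j + 1) * rout) := by nlinarith
  have h2 : (j ^ 2 - 1) * m ≤ (j + 1) * (((t : ℤ) - 1) * e) := by nlinarith
  nlinarith

/-- **THE POS-CERTIFICATE PAIR FAILS IN THE TAIL**: with the radii SWAPPED as in `hullCell_of_bounds` (`r_in := r_out_lb ≤ p^t − t·e` very negative,
`r_out := r_in_ub ≥ 1`), the closed form FAILS for every `m ≥ 0`, `j ≥ 1` as soon as `p^t ≤ e` with `t ≥ 2` (`e·⌊X/e⌋ > X − e` and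
`X ≥ j²m − je + j + (j+1)(t−1)e`). So in the l-tail (`e_w ≥ l ≥ p²`) the certified column can certify NEITHER side: it is constantly OPEN. [folklore] -/
theorem not_hullCell_swapped_of_ltail {p : ℕ} {e m j rin rout : ℤ} {t : ℕ} (he : 0 < e) (hj : 1 ≤ j) (hm : 0 ≤ m)
    (hrin : rin ≤ (p : ℤ) ^ t - t * e) (hrout : 1 ≤ rout) (hpt : (p : ℤ) ^ t ≤ e) (ht : 2 ≤ t) :
    ¬ HullCell e m j rin rout := by
  unfold HullCell
  intro hc
  set X : ℤ := j ^ 2 * m - j * (e - 1) - (j + 1) * rin with hX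
  have hdiv : X - e < e * (X / e) := by
    have h1 := Int.lt_mul_ediv_self_add (x := X) he
    linarith
  have hj0 : 0 ≤ j + 1 := by linarith
  have htR : (2 : ℤ) ≤ (t : ℤ) := by exact_mod_cast ht
  have h1 : (j + 1) * ((t : ℤ) * e - (p : ℤ) ^ t) ≤ -((j + 1) * rin) := by nlinarith
  have h2 : j + 1 ≤ (j + 1) * rout := by nlinarith
  have h3 : (j + 1) * e ≤ (j + 1) * ((t : ℤ) * e - (p : ℤ) ^ t) :=
    mul_le_mul_of_nonneg_left (by nlinarith) hj0
  have h4 : 0 ≤ (j ^ 2 - 1) * m := mul_nonneg (by nlinarith) hm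
  have h5 : j * (e - 1) ≤ j * e := by nlinarith
  nlinarith

variable {F K Fbar : Type} [Field F] [NumberField F] [Field K] [NumberField K] [Algebra F K] [Field Fbar]
  [Algebra F Fbar] [Algebra K Fbar] {E : WeierstrassCurve F} [E.IsElliptic] {l : ℕ} {Pb : BadPlacePredicates K}
  (D : InitialThetaData F K Fbar E l Pb)

/-- **ROW 4, GENUINE CELL IN THE l-TAIL** (`w`-units, the currency of `HStarClosedForm`): at a bad place `w | p` over `v` with pilot degree
`P_q(w) = P`, if `p^t ≤ l` and `ord_v(q_v) + 4·e(v|p) ≤ 4·e(v|p)·t`, then `HullCell e_w P (i+1) r_in r_out` for EVERY pair with `1 ≤ r_in` and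
`r_out ≤ p^t − t·e_w`. Instances: (i) the NEG-test pair `(r_in_ub, r_out_lb) = (⌊e/(p−1)⌋+1, min_s(p^s − s·e))` qualifies, so NO cell of the datum is
NEG-certified (`not_hullCell_of_bounds` never fires); (ii) the EXACT radii qualify whenever `r_out(K_w) ≤ p^t − t·e_w` (untied depth; R-W lane U).
[cite: Mochizuki2012, IUTchI Ex. 3.2 (iv) p. 71; IUTchIV Prop. 1.2 (i)(ii) p. 10, Prop. 1.4 p. 13] [claim: Mochizuki2012, status: disputed] -/
theorem hullCell_pilotDataOfK_of_ltail (pp : Nat.Primes) (i : Fin (pilotDataOfK D K).lstar)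
    (w : (thetaIndex (pilotDataOfK D K)).Fibre (.inr pp))
    (hw : haveI : Fact (pp : ℕ).Prime := ⟨pp.2⟩; placeOf (pilotDataOfK D K) pp.1 w ∈ (pilotDataOfK D K).S)
    (t : ℕ) (hpt : (pp : ℕ) ^ t ≤ l)
    (hn : haveI : Fact (pp : ℕ).Prime := ⟨pp.2⟩
      qParamOrd E (finBelow F K (placeOf (pilotDataOfK D K) pp.1 w)) + 4 * ramIdx F (finBelow F K (placeOf (pilotDataOfK D K) pp.1 w)) ≤
        4 * ramIdx F (finBelow F K (placeOf (pilotDataOfK D K) pp.1 w)) * t)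
    (P : ℕ) (hP : haveI : Fact (pp : ℕ).Prime := ⟨pp.2⟩; (pilotDataOfK D K).qPilot (placeOf (pilotDataOfK D K) pp.1 w) = P)
    (rin rout : ℤ) (hrin : 1 ≤ rin)
    (hrout : haveI : Fact (pp : ℕ).Prime := ⟨pp.2⟩
      rout ≤ ((pp : ℕ) : ℤ) ^ t - t * ((placeOf (pilotDataOfK D K) pp.1 w).asIdeal.ramificationIdx ℤ : ℤ)) :
    haveI : Fact (pp : ℕ).Prime := ⟨pp.2⟩
    HullCell ((placeOf (pilotDataOfK D K) pp.1 w).asIdeal.ramificationIdx ℤ : ℤ) (P : ℤ) ((i : ℕ) + 1 : ℤ) rin rout := by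
  haveI hF : Fact (pp : ℕ).Prime := ⟨pp.2⟩
  set w₀ := placeOf (pilotDataOfK D K) pp.1 w with hw₀
  set v := finBelow F K w₀ with hv
  obtain ⟨P', hP', -, h2lP⟩ := exists_nat_qPilot_pilotDataOfK D hw
  have hPP : P' = P := by
    have : (P' : ℝ) = P := by rw [← hP', hP]
    exact_mod_cast this
  subst hPP
  have htower : w₀.asIdeal.ramificationIdx ℤ = ramIdx F v * Ideal.ramificationIdx' v.asIdeal w₀.asIdeal :=
    ThetaData.absRamificationIdx_eq_ramIdx_mul (F := F) w₀
  have hVF : FinitePlace.mk v ∈ D.VFbad := (mem_pilotDataOfK_S_iff D K w₀).mp hw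
  have hlr : l ≤ Ideal.ramificationIdx' v.asIdeal w₀.asIdeal := ThetaData.l_le_ramificationIdx_of_under_mem_VFbad D hVF
  have he0 : 0 < ramIdx F v := Nat.pos_of_ne_zero (ramIdx_ne_zero F v)
  have hi : 2 * (i : ℕ) + 3 ≤ l := by
    have h1 : (i : ℕ) < (pilotDataOfK D K).lstar := i.2
    have h2 : (pilotDataOfK D K).lstar = (l - 1) / 2 := by unfold PilotData.lstar; rw [pilotDataOfK_l]
    omega
  have ht1 : 1 ≤ t := by
    by_contra h0
    have : t = 0 := by omega
    subst this
    have := he0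
    omega
  -- integer key inequality `i·P ≤ (t−1)·e(w|p)` from `2l·P = e(w|v)·ord_v(q_v)`
  have hkey : (i : ℕ) * P' ≤ (t - 1) * w₀.asIdeal.ramificationIdx ℤ := by
    have hl0 : 0 < 2 * l := by omega
    refine Nat.le_of_mul_le_mul_left ?_ hl0
    have hn' : qParamOrd E v ≤ 4 * ramIdx F v * (t - 1) := by
      have : 4 * ramIdx F v * (t - 1) = 4 * ramIdx F v * t - 4 * ramIdx F v := by
        rw [Nat.mul_sub, Nat.mul_one]
      omega
    rw [htower]
    calc 2 * l * ((i : ℕ) * P') = (i : ℕ) * (2 * l * P') := by ring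
      _ = (i : ℕ) * (Ideal.ramificationIdx' v.asIdeal w₀.asIdeal * qParamOrd E v) := by rw [h2lP]
      _ ≤ (i : ℕ) * (Ideal.ramificationIdx' v.asIdeal w₀.asIdeal * (4 * ramIdx F v * (t - 1))) := by gcongr
      _ = (4 * (i : ℕ)) * (ramIdx F v * Ideal.ramificationIdx' v.asIdeal w₀.asIdeal * (t - 1)) := by ring
      _ ≤ (2 * l) * (ramIdx F v * Ideal.ramificationIdx' v.asIdeal w₀.asIdeal * (t - 1)) :=
          Nat.mul_le_mul_right _ (by omega)
      _ = 2 * l * ((t - 1) * (ramIdx F v * Ideal.ramificationIdx' v.asIdeal w₀.asIdeal)) := by ring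
  have hepos : 0 < w₀.asIdeal.ramificationIdx ℤ := by
    rw [htower]; exact Nat.mul_pos he0 (lt_of_lt_of_le (by omega) hlr)
  have hpte : (pp : ℕ) ^ t ≤ w₀.asIdeal.ramificationIdx ℤ := by
    rw [htower]
    calc (pp : ℕ) ^ t ≤ l := hpt
      _ ≤ Ideal.ramificationIdx' v.asIdeal w₀.asIdeal := hlr
      _ ≤ ramIdx F v * Ideal.ramificationIdx' v.asIdeal w₀.asIdeal := Nat.le_mul_of_pos_left _ he0
  refine hullCell_of_linear (p := (pp : ℕ)) (t := t) (by exact_mod_cast hepos) (by omega) hrin hrout (by exact_mod_cast hpte) ?_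
  have hkeyZ : ((i : ℕ) : ℤ) * (P' : ℤ) ≤ (((t - 1 : ℕ)) : ℤ) * (w₀.asIdeal.ramificationIdx ℤ : ℤ) := by exact_mod_cast hkey
  have hsub : (((t - 1 : ℕ)) : ℤ) = (t : ℤ) - 1 := by omega
  rw [hsub] at hkeyZ
  have : ((i : ℕ) + 1 : ℤ) - 1 = ((i : ℕ) : ℤ) := by ring
  rw [this]
  exact hkeyZ

/-- **ROW 4, DATUM FORM for the closed-form reading with radii supplied as data** (`RH.HullThresholdExact.HStarClosedForm`): if every bad place
passes the l-tail test with some `t` and the supplied radii satisfy `1 ≤ r_in(w)`, `r_out(w) ≤ p^t − t·e_w`, then `HStarClosedForm (pilotDataOfK D K) r_in r_out`.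
With `(r_in, r_out) := (r_in_ub, r_out_lb)` this says: NO NEG-certificate anywhere in the datum. [claim: Mochizuki2012, status: disputed] -/
theorem hStarClosedForm_pilotDataOfK_of_ltail
    (rin rout : ∀ pp : Nat.Primes, (thetaIndex (pilotDataOfK D K)).Fibre (.inr pp) → ℤ)
    (h : ∀ (pp : Nat.Primes) (w : (thetaIndex (pilotDataOfK D K)).Fibre (.inr pp)),
      haveI : Fact (pp : ℕ).Prime := ⟨pp.2⟩
      placeOf (pilotDataOfK D K) pp.1 w ∈ (pilotDataOfK D K).S →
        ∃ t : ℕ, (pp : ℕ) ^ t ≤ l ∧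
          qParamOrd E (finBelow F K (placeOf (pilotDataOfK D K) pp.1 w)) + 4 * ramIdx F (finBelow F K (placeOf (pilotDataOfK D K) pp.1 w)) ≤
            4 * ramIdx F (finBelow F K (placeOf (pilotDataOfK D K) pp.1 w)) * t ∧
          1 ≤ rin pp w ∧ rout pp w ≤ ((pp : ℕ) : ℤ) ^ t - t * ((placeOf (pilotDataOfK D K) pp.1 w).asIdeal.ramificationIdx ℤ : ℤ)) :
    HStarClosedForm (pilotDataOfK D K) rin rout := by
  intro pp i w hw P hP
  obtain ⟨t, hpt, hn, hrin, hrout⟩ := h pp w hw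
  exact hullCell_pilotDataOfK_of_ltail D pp i w hw t hpt hn P hP (rin pp w) (rout pp w) hrin hrout

end Row4

end Summit.ABC.IUTFork.Repair.RH.Q3LTailHull

end
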